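import Literature.AnabelianGeometry.SemiGraphs.PSCSeparatingCoveringsCutoffVertex
import Literature.GroupTheory.CombinatorialGroupTheory.FreeFactorFibredTwistNonabelian
import Literature.GroupTheory.CombinatorialGroupTheory.PuncturedSurfaceGroupLevelCuspSeparation
import HarnessLib

/-!
# [CombGC] Prop. 1.2, proof p. 9: separating two level nodes over a node that bounds a cuspless component

Mochizuki, *A combinatorial version of the Grothendieck conjecture*, Tohoku Math. J. **59** (2007)
[CombGC], PROOF of Proposition 1.2, author's manuscript p. 9, edge case ("there exists a finite étale …
`Π_G`-covering `G' → G` whose restriction to the anabelioid `G_{e₂}` is trivial, but whose restriction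
to the anabelioid `G_{e₁}` is nontrivial … by gluing together appropriate finite étale coverings of the
anabelioids `G_v`, `G_e`") [cite: MochizukiCombGC2007, Prop 1.2 proof p.9]; typed LEVEL-WISE as the
same-edge clause of `PSCDatum.EdgeLikeSeparatingCoverings` (abc-iut-w4-d081, row P12-L01-E; FACT-LIST
row F-2827).

PROOF-ONLY file (abc-iut-f-164 gen 5).  abc-iut-f-166's rank-one engine needs the node loop to be a member
of a free basis of `π₁`.  The node of a two-component curve one of whose components `C₁` carries NO marked
point is not of that kind: its loop `ε = (∏_{i ≥ g₀}[a_i, b_i])⁻¹` is the BOUNDARY of the free factor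
`B = ⟨a_i, b_i : i ≥ g₀⟩ ≅ Γ_{g₁,1}` (`ε ↔ c₀`) and lies in `[π₁, π₁]`; moreover two level nodes at a
cuspless level component cannot be separated by any ABELIAN quotient of the level (their loops are inverse
modulo commutators when the component meets exactly these two nodes).  This file proves the same-edge
clause for such BOUNDARY NODES with nonabelian monodromy:

* `IsProSigmaCompletion.boundaryNode_exists_open_separating_sameEdge` — `ι : Γ → Π` a profinite pro-`Σ`
  completion of a free group, `B = ⟨b(S)⟩` a free factor, `θ : Γ_{h,1} ↪ Γ` (`h ≥ 1`) an embedding with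
  image `B`, `E = cl ι⟨θ(c₀)⟩` the node group, `ℓ ∈ Σ`, `V ⊴ Π` open, `Vγ₁E ≠ Vγ₂E`: there is an open
  `U ≤ V`, normal in `V`, with `γ₂Eγ₂⁻¹ ∩ V ≤ U` and `γ₁Eγ₁⁻¹ ∩ V ⊄ U`.  At the discrete level
  `K = ι⁻¹(V)`: the Heisenberg quotient of `K_B = θ⁻¹(K) ≅ Γ_{g',r'}` separating the cusp over the sheet
  of `1` from all other cusps (`PuncturedSurfaceGroupLevelCuspSeparation.lean`, via Hoare–Karrass–Solitar)
  is extended from `B ∩ K` to `K` by the NONABELIAN fibred twist (`FreeFactorFibredTwistNonabelian.lean`),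
  which kills the other level vertices over `B`; the two level nodes are either at the same level vertex
  (separated by the Heisenberg quotient) or at different ones (separated by the twist); `V` is the pro-`Σ`
  completion of `K`, so the resulting `U' ⊴ K` of `ℓ`-power index is the trace of an open `U ⊴ V`.

Instance-level tool at data of the shape of genuine curves; 0 definitions; nothing here takes a side on
[IUTchIII] Cor. 3.12.
-/

noncomputable section

namespace Literature.AnabelianGeometry.SemiGraphs

open scoped Pointwise
open Literature.AnabelianGeometry.Anabelioids (IsSigmaInteger)
open Literature.GroupTheory.CombinatorialGroupTheory
open Literature.GroupTheory.CombinatorialGroupTheory.PuncturedSurfaceGroup (c cuspInertia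
  exists_hom_heisenberg_separating_peripherals)
open Literature.GroupTheory.CombinatorialGroupTheory.FreeFactorFibredTwistNonabelian
  (exists_normal_separating_of_freeFactor_hom)

universe u

/-! ### Bookkeeping -/

section Bookkeeping

variable {P : Type*} [Group P]

/-- `f (a H a⁻¹) = f(a) f(H) f(a)⁻¹`. [folklore] -/
private theorem map_toConjAct_smul₃ {Γ : Type*} [Group Γ] (f : Γ →* P) (a : Γ) (H : Subgroup Γ) :
    (ConjAct.toConjAct a • H).map f = ConjAct.toConjAct (f a) • H.map f := by
  rw [← map_conj_eq_conjAct_smul, ← map_conj_eq_conjAct_smul, Subgroup.map_map, Subgroup.map_map]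
  congr 1
  ext x
  simp [MulAut.conj_apply]

/-- The image in `Π` of a subgroup `U'` normal in `V` is stable under conjugation by `V`. [folklore] -/
private theorem conjAct_smul_map_subtype_of_mem₃ {V : Subgroup P} (U' : Subgroup V) [hU : U'.Normal]
    {t : P} (ht : t ∈ V) : ConjAct.toConjAct t • U'.map V.subtype = U'.map V.subtype := by
  ext x
  rw [Subgroup.mem_pointwise_smul_iff_inv_smul_mem, ← map_inv, ConjAct.smul_def,
    ConjAct.ofConjAct_toConjAct, inv_inv]
  constructor
  · intro hx
    obtain ⟨u, hu, hux⟩ := Subgroup.mem_map.mp hx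
    refine Subgroup.mem_map.mpr ⟨⟨t, ht⟩ * u * ⟨t, ht⟩⁻¹, hU.conj_mem u hu ⟨t, ht⟩, ?_⟩
    have hux' : (u : P) = t⁻¹ * x * t := hux
    change ((⟨t, ht⟩ * u * ⟨t, ht⟩⁻¹ : V) : P) = x
    rw [Subgroup.coe_mul, Subgroup.coe_mul, Subgroup.coe_inv, hux']
    group
  · intro hx
    obtain ⟨u, hu, rfl⟩ := Subgroup.mem_map.mp hx
    refine Subgroup.mem_map.mpr ⟨⟨t, ht⟩⁻¹ * u * ⟨t, ht⟩⁻¹⁻¹, hU.conj_mem u hu ⟨t, ht⟩⁻¹, ?_⟩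
    change ((⟨t, ht⟩⁻¹ * u * ⟨t, ht⟩⁻¹⁻¹ : V) : P) = t⁻¹ * (u : P) * t
    rw [inv_inv, Subgroup.coe_mul, Subgroup.coe_mul, Subgroup.coe_inv]

/-- For `U'` normal in `V` and `t ∈ V`: `t B t⁻¹ ⊆ U'` iff `B ⊆ U'`. [cite: MochizukiCombGC2007, Def 1.1(ii) p.6] -/
private theorem conjAct_smul_le_iff₃ {V : Subgroup P} (U' : Subgroup V) [U'.Normal] {t : P} (ht : t ∈ V)
    (B : Subgroup P) : ConjAct.toConjAct t • B ≤ U'.map V.subtype ↔ B ≤ U'.map V.subtype := by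
  conv_lhs => rw [← conjAct_smul_map_subtype_of_mem₃ U' ht]
  exact Subgroup.pointwise_smul_le_pointwise_smul_iff

/-- For `U'` normal in `V`, `t ∈ V`, `u ∈ U'`: `t u t⁻¹ ∈ U'`. [cite: MochizukiCombGC2007, Def 1.1(ii) p.6] -/
private theorem conj_mem_map_subtype₃ {V : Subgroup P} (U' : Subgroup V) [U'.Normal] {t : P} (ht : t ∈ V)
    {u : P} (hu : u ∈ U'.map V.subtype) : t * u * t⁻¹ ∈ U'.map V.subtype := by
  rw [← conjAct_smul_map_subtype_of_mem₃ U' ht]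
  exact Subgroup.mem_pointwise_smul_iff_inv_smul_mem.mpr (by
    rw [← map_inv, ConjAct.smul_def, ConjAct.ofConjAct_toConjAct]
    simpa [mul_assoc] using hu)

end Bookkeeping

/-! ### The same-edge separating covering for a boundary node -/

namespace SemiGraphOfAnabelioids.IsProSigmaCompletion

variable {Sigma : Set ℕ} {Γ : Type*} [Group Γ] {P : Type*} [Group P] [TopologicalSpace P]
  [IsTopologicalGroup P] [CompactSpace P] [TotallyDisconnectedSpace P] {ι : Γ →* P}

/-- **[CombGC] Prop. 1.2, proof p. 9 — separating two level nodes over a BOUNDARY node.**  `ι : Γ → Π`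
a profinite pro-`Σ` completion of a free group `Γ` with basis `b`; `B = ⟨b(S)⟩` a free factor carrying an
embedding `θ : Γ_{h,1} ↪ Γ` (`h ≥ 1`) with image `B`; `E = cl ι⟨θ(c₀)⟩` (the node group: the boundary of
`B`); `ℓ ∈ Σ` prime; `V ⊴ Π` open; `γ₁, γ₂` with `Vγ₁E ≠ Vγ₂E`.  Then there is an open `U ≤ V`, normal
in `V`, with `γ₂Eγ₂⁻¹ ∩ V ≤ U` and `γ₁Eγ₁⁻¹ ∩ V ⊄ U`. [cite: MochizukiCombGC2007, Prop 1.2 proof p.9] -/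
theorem boundaryNode_exists_open_separating_sameEdge (hι : IsProSigmaCompletion Sigma ι)
    {β : Type*} (b : FreeGroupBasis β Γ) (S : Set β) (B : Subgroup Γ) (hB : B = Subgroup.closure (b '' S))
    {h : ℕ} (hh : 1 ≤ h) (θ : PuncturedSurfaceGroup h 1 →* Γ) (hθ : Function.Injective θ)
    (hθB : θ.range = B) {ℓ : ℕ} (hℓ : ℓ.Prime) (hℓS : ℓ ∈ Sigma)
    (E : Subgroup P) (hE : E = ((Subgroup.zpowers (θ (c 0))).map ι).topologicalClosure)
    (V : Subgroup P) [hVn : V.Normal] (hVo : IsOpen (V : Set P)) (γ₁ γ₂ : ConjAct P)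
    (hne : DoubleCoset.doubleCoset (ConjAct.ofConjAct γ₁) (V : Set P) (E : Set P) ≠
      DoubleCoset.doubleCoset (ConjAct.ofConjAct γ₂) (V : Set P) (E : Set P)) :
    ∃ U : Subgroup P, IsOpen (U : Set P) ∧ U ≤ V ∧ (U.subgroupOf V).Normal ∧
      (γ₂ • E) ⊓ V ≤ U ∧ ¬ ((γ₁ • E) ⊓ V ≤ U) := by
  classical
  haveI : Fact (1 < ℓ) := ⟨hℓ.one_lt⟩
  set EΓ : Subgroup Γ := Subgroup.zpowers (θ (c 0)) with hEΓ
  have hEB : EΓ ≤ B := by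
    rw [hEΓ, Subgroup.zpowers_le, ← hθB]
    exact ⟨c 0, rfl⟩
  -- (A) the discrete level
  obtain ⟨K, hK⟩ : ∃ K : Subgroup Γ, K = V.comap ι := ⟨_, rfl⟩
  haveI hKn : K.Normal := by rw [hK]; infer_instance
  haveI : K.FiniteIndex := by rw [hK]; exact finiteIndex_comap hι V hVo
  -- (B) representatives of the two level nodes in `ι(Γ)`, up to `V`
  have stepB : ∀ γ : ConjAct P, ∃ (f : Γ) (w : P), w ∈ V ∧
      (γ • E) ⊓ V = ConjAct.toConjAct w • ((ConjAct.toConjAct (ι f) • E) ⊓ V) ∧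
      DoubleCoset.doubleCoset (ConjAct.ofConjAct γ) (V : Set P) (E : Set P) =
        DoubleCoset.doubleCoset (ι f) (V : Set P) (E : Set P) := by
    intro γ
    obtain ⟨f, hf⟩ := exists_mem_coset hι V hVo (ConjAct.ofConjAct γ)
    have hw : ConjAct.ofConjAct γ * (ι f)⁻¹ ∈ V := by
      have h1 := hVn.conj_mem _ (V.inv_mem hf) (ConjAct.ofConjAct γ)
      simpa [mul_assoc] using h1
    refine ⟨f, ConjAct.ofConjAct γ * (ι f)⁻¹, hw, ?_, ?_⟩
    · rw [Subgroup.smul_inf, conjAct_smul_eq_self_of_mem hw, ← mul_smul, ← map_mul,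
        inv_mul_cancel_right, ConjAct.toConjAct_ofConjAct]
    · exact DoubleCoset.doubleCoset_eq_of_mem (DoubleCoset.mem_doubleCoset.mpr
        ⟨ConjAct.ofConjAct γ * (ι f)⁻¹, hw, 1, E.one_mem, by group⟩)
  obtain ⟨f₁, w₁, hw₁, hA₁, hdc₁⟩ := stepB γ₁
  obtain ⟨f₂, w₂, hw₂, hA₂, hdc₂⟩ := stepB γ₂
  have hlevel : ∀ f : Γ, (ConjAct.toConjAct (ι f) • E) ⊓ V =
      ((ConjAct.toConjAct f • (EΓ ⊓ K)).map ι).topologicalClosure := by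
    intro f
    rw [hE, ← topologicalClosure_conjAct_smul, ← map_toConjAct_smul₃, topologicalClosure_map_inf_of_isOpen
      ι _ V hVo, Subgroup.smul_inf, hKn.conjAct, hK]
  -- (C) distinct level nodes: `f₁⁻¹ f₂ ∉ E_Γ · K`
  have hδ : f₁⁻¹ * f₂ ∉ (EΓ : Set Γ) * (K : Set Γ) := by
    intro hmem
    obtain ⟨a, ha, k, hk, hak⟩ := Set.mem_mul.mp hmem
    apply hne
    rw [hdc₁, hdc₂]
    symm
    have hkV : ι k ∈ V := by rw [hK] at hk; exact hk
    have haA : ι a ∈ E := by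
      rw [hE]
      exact Subgroup.le_topologicalClosure _ (Subgroup.mem_map_of_mem ι ha)
    refine DoubleCoset.doubleCoset_eq_of_mem (DoubleCoset.mem_doubleCoset.mpr
      ⟨ι f₁ * ι a * ι k * (ι f₁ * ι a)⁻¹, hVn.conj_mem _ hkV (ι f₁ * ι a), ι a, haA, ?_⟩)
    have hf₂ : f₂ = f₁ * (a * k) := by rw [hak, mul_inv_cancel_left]
    rw [hf₂, map_mul, map_mul]
    group
  -- (D) the discrete separating subgroup: Heisenberg quotient of `K_B = θ⁻¹(K)`, nonabelian twist
  set K_B : Subgroup (PuncturedSurfaceGroup h 1) := K.comap θ with hK_B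
  haveI : K_B.Normal := by rw [hK_B]; infer_instance
  haveI : K_B.FiniteIndex := by
    have hker : K_B = ((QuotientGroup.mk' K).comp θ).ker := by
      rw [hK_B, ← MonoidHom.comap_ker, QuotientGroup.ker_mk']
    refine ⟨?_⟩
    rw [hker, Subgroup.index_ker]
    exact Nat.card_pos.ne'
  obtain ⟨σ, τ, hcard, hkill, x₀, hx₀K, hx₀c, hx₀τ⟩ := exists_hom_heisenberg_separating_peripherals hh ℓ K_B
  -- `B ≅ Γ_{h,1}` and the homomorphism `φ : B ∩ K → H_ℓ`
  let eB : PuncturedSurfaceGroup h 1 ≃* B :=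
    (MonoidHom.ofInjective hθ).trans (MulEquiv.subgroupCongr hθB)
  have heB : ∀ w, ((eB w : B) : Γ) = θ w := fun _ => rfl
  have heB' : ∀ y : B, θ (eB.symm y) = y := fun y => by
    rw [← heB (eB.symm y), MulEquiv.apply_symm_apply]
  haveI : Finite (Multiplicative (ZMod ℓ × ZMod ℓ) ⋊[σ] Multiplicative (ZMod ℓ)) :=
    Finite.of_equiv _ SemidirectProduct.equivProd.symm
  let ψ₀ : ↥(B ⊓ K) →* PuncturedSurfaceGroup h 1 :=
    eB.symm.toMonoidHom.comp (Subgroup.inclusion inf_le_left)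
  have hψ₀ : ∀ y : ↥(B ⊓ K), θ (ψ₀ y) = (y : Γ) := fun y => heB' _
  have hψ₀K : ∀ y : ↥(B ⊓ K), ψ₀ y ∈ K_B := fun y => by
    rw [hK_B, Subgroup.mem_comap, hψ₀]
    exact y.2.2
  let φ : ↥(B ⊓ K) →* (Multiplicative (ZMod ℓ × ZMod ℓ) ⋊[σ] Multiplicative (ZMod ℓ)) :=
    τ.comp (ψ₀.codRestrict K_B hψ₀K)
  have hφ : ∀ y : ↥(B ⊓ K), φ y = τ ⟨ψ₀ y, hψ₀K y⟩ := fun _ => rfl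
  obtain ⟨U', hU'n, hU'idx, hU'iff, hU'off⟩ :=
    exists_normal_separating_of_freeFactor_hom b S B hB K φ f₁
  -- (E) `V` is the pro-`Σ` completion of `K`: `U'` is the trace of an open `U₀ ⊴ V`
  subst hK
  haveI := hU'n
  have hU'S : IsSigmaInteger Sigma U'.index := by
    rw [hcard] at hU'idx
    obtain ⟨k, -, hk⟩ := (Nat.dvd_prime_pow hℓ).mp hU'idx
    rw [hk]
    exact isSigmaInteger_prime_pow hℓ hℓS k
  have hι' : IsProSigmaCompletion Sigma (ι.subgroupComap V) := restrict hι V hVo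
  obtain ⟨U₀, hU₀o, hU₀c⟩ := exists_isOpen_comap_subgroupComap_eq hι V hVo U' hU'S
  haveI hU₀n : U₀.Normal := normal_of_comap_normal hι' U₀ hU₀o (by rw [hU₀c]; exact hU'n)
  have hUo : IsOpen ((U₀.map V.subtype : Subgroup P) : Set P) := isOpen_map_subtype V hVo U₀ hU₀o
  have hdict : ∀ {z : Γ} (hz : z ∈ V.comap ι), ι z ∈ U₀.map V.subtype ↔ z ∈ U'.map (V.comap ι).subtype := by
    intro z hz
    constructor
    · intro hzU
      obtain ⟨u, hu, huz⟩ := Subgroup.mem_map.mp hzU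
      have hu' : u = ι.subgroupComap V ⟨z, hz⟩ := Subtype.ext huz
      rw [hu', ← Subgroup.mem_comap, hU₀c] at hu
      exact Subgroup.mem_map.mpr ⟨⟨z, hz⟩, hu, rfl⟩
    · intro hzU
      obtain ⟨u, hu, huz⟩ := Subgroup.mem_map.mp hzU
      rw [← hU₀c, Subgroup.mem_comap] at hu
      have huz' : (u : Γ) = z := huz
      refine Subgroup.mem_map.mpr ⟨ι.subgroupComap V u, hu, ?_⟩
      change ι (u : Γ) = ι z
      rw [huz']
  -- the two discrete facts
  have hK' : ∀ {y : Γ}, y ∈ V.comap ι → ∀ g : Γ, g * y * g⁻¹ ∈ V.comap ι := fun hy g =>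
    (inferInstance : (V.comap ι).Normal).conj_mem _ hy g
  have hnot : ¬ (ConjAct.toConjAct f₁ • (EΓ ⊓ V.comap ι) ≤ U'.map (V.comap ι).subtype) := by
    intro hle
    apply hx₀τ
    have hy₁E : θ x₀ ∈ EΓ := by
      obtain ⟨n, rfl⟩ := Subgroup.mem_zpowers_iff.mp hx₀c
      rw [map_zpow]
      exact Subgroup.zpow_mem_zpowers _ _
    have hy₁K : θ x₀ ∈ V.comap ι := hx₀K
    have hy₁B : θ x₀ ∈ B := hEB hy₁E
    have hmem : f₁ * θ x₀ * f₁⁻¹ ∈ U'.map (V.comap ι).subtype := by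
      refine hle ?_
      rw [Subgroup.mem_smul_pointwise_iff_exists]
      exact ⟨θ x₀, ⟨hy₁E, hy₁K⟩, by rw [ConjAct.smul_def, ConjAct.ofConjAct_toConjAct]⟩
    obtain ⟨u, hu, hu'⟩ := Subgroup.mem_map.mp hmem
    have hu'' : u = ⟨f₁ * θ x₀ * f₁⁻¹, hK' hy₁K f₁⟩ := Subtype.ext hu'
    rw [hu''] at hu
    have h1 := (hU'iff (θ x₀) ⟨hy₁B, hy₁K⟩).mp hu
    rw [hφ] at h1
    have h2 : (⟨ψ₀ ⟨θ x₀, ⟨hy₁B, hy₁K⟩⟩, hψ₀K _⟩ : K_B) = ⟨x₀, hx₀K⟩ :=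
      Subtype.ext (hθ (by rw [hψ₀]))
    rwa [h2] at h1
  have hyes : ConjAct.toConjAct f₂ • (EΓ ⊓ V.comap ι) ≤ U'.map (V.comap ι).subtype := by
    by_cases hBK : f₁⁻¹ * f₂ ∈ (B : Set Γ) * (V.comap ι : Set Γ)
    · -- same level vertex over `B`: the Heisenberg quotient kills the other node
      obtain ⟨βt, hβt, n, hn, hβn⟩ := Set.mem_mul.mp hBK
      set βs : PuncturedSurfaceGroup h 1 := eB.symm ⟨βt, hβt⟩ with hβs
      have hθβ : θ βs = βt := heB' ⟨βt, hβt⟩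
      have hβ : ∀ k ∈ K_B, ∀ z ∈ cuspInertia (0 : Fin 1), βs ≠ k * z := by
        intro k hk z hz hkz
        apply hδ
        have hθz : θ z ∈ EΓ := by
          obtain ⟨m, rfl⟩ := Subgroup.mem_zpowers_iff.mp hz
          rw [map_zpow]
          exact Subgroup.zpow_mem_zpowers _ _
        have hθk : θ k ∈ V.comap ι := hk
        have e1 : f₁⁻¹ * f₂ = θ z * ((θ z)⁻¹ * θ k * θ z * n) := by
          rw [← hβn, ← hθβ, hkz, map_mul]
          group
        rw [e1]
        exact Set.mul_mem_mul hθz ((V.comap ι).mul_mem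
          (by simpa using hK' hθk (θ z)⁻¹) hn)
      intro z hz
      obtain ⟨y, ⟨hyE, hyK⟩, rfl⟩ := (Subgroup.mem_smul_pointwise_iff_exists _ _ _).mp hz
      rw [ConjAct.smul_def, ConjAct.ofConjAct_toConjAct]
      have hyB : y ∈ B := hEB hyE
      -- `f₂ y f₂⁻¹ = n' (f₁ (β y β⁻¹) f₁⁻¹) n'⁻¹`, `n' = f₁ β n β⁻¹ f₁⁻¹ ∈ K`
      have hf₂ : f₂ = f₁ * (βt * n) := by rw [hβn, mul_inv_cancel_left]
      have hn' : f₁ * βt * n * βt⁻¹ * f₁⁻¹ ∈ V.comap ι := by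
        have := hK' hn (f₁ * βt)
        simpa [mul_assoc] using this
      have hconjK : βt * y * βt⁻¹ ∈ V.comap ι := hK' hyK βt
      have hconjB : βt * y * βt⁻¹ ∈ B := B.mul_mem (B.mul_mem hβt hyB) (B.inv_mem hβt)
      have hin : (⟨f₁ * (βt * y * βt⁻¹) * f₁⁻¹, hK' hconjK f₁⟩ : V.comap ι) ∈ U' := by
        refine (hU'iff (βt * y * βt⁻¹) ⟨hconjB, hconjK⟩).mpr ?_
        rw [hφ]
        refine hkill βs hβ _ (hψ₀K _) ?_
        -- `ψ₀ (β y β⁻¹) = βs · eB⁻¹(y) · βs⁻¹ ∈ βs ⟨c₀⟩ βs⁻¹`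
        have hw : eB.symm ⟨y, hyB⟩ ∈ cuspInertia (0 : Fin 1) := by
          obtain ⟨m, hm⟩ := Subgroup.mem_zpowers_iff.mp hyE
          have : eB.symm ⟨y, hyB⟩ = c 0 ^ m := hθ (by rw [heB', map_zpow]; exact hm.symm)
          rw [this]
          exact Subgroup.zpow_mem_zpowers _ _
        have hψy : ψ₀ ⟨βt * y * βt⁻¹, ⟨hconjB, hconjK⟩⟩ = βs * eB.symm ⟨y, hyB⟩ * βs⁻¹ := by
          have e : (Subgroup.inclusion (inf_le_left : B ⊓ V.comap ι ≤ B)) ⟨βt * y * βt⁻¹, ⟨hconjB, hconjK⟩⟩ =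
              ⟨βt, hβt⟩ * ⟨y, hyB⟩ * ⟨βt, hβt⟩⁻¹ := Subtype.ext rfl
          change eB.symm ((Subgroup.inclusion (inf_le_left : B ⊓ V.comap ι ≤ B)) _) = _
          rw [e, map_mul, map_mul, map_inv]
        rw [hψy]
        exact Subgroup.mem_map.mpr ⟨eB.symm ⟨y, hyB⟩, hw, by simp [MulAut.conj_apply]⟩
      have hin' : f₁ * (βt * y * βt⁻¹) * f₁⁻¹ ∈ U'.map (V.comap ι).subtype :=
        Subgroup.mem_map.mpr ⟨_, hin, rfl⟩
      have e2 : f₂ * y * f₂⁻¹ = (f₁ * βt * n * βt⁻¹ * f₁⁻¹) * (f₁ * (βt * y * βt⁻¹) * f₁⁻¹) *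
          (f₁ * βt * n * βt⁻¹ * f₁⁻¹)⁻¹ := by
        rw [hf₂]
        group
      rw [e2]
      exact conj_mem_map_subtype₃ U' hn' hin'
    · exact (Subgroup.pointwise_smul_le_pointwise_smul_iff.mpr (inf_le_inf_right _ hEB)).trans
        (hU'off f₂ hBK)
  refine ⟨U₀.map V.subtype, hUo, Subgroup.map_subtype_le U₀, ?_, ?_, ?_⟩
  · rw [← Subgroup.comap_subtype, Subgroup.comap_map_eq_self_of_injective V.subtype_injective]
    exact hU₀n
  · -- trivial over the node of `f₂`
    rw [hA₂, conjAct_smul_le_iff₃ U₀ hw₂, hlevel f₂]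
    refine Subgroup.topologicalClosure_minimal _ ?_ (Subgroup.isClosed_of_isOpen _ hUo)
    rintro _ ⟨z, hz, rfl⟩
    have hzU : z ∈ U'.map (V.comap ι).subtype := hyes hz
    obtain ⟨u, -, huz⟩ := Subgroup.mem_map.mp hzU
    have hzK : z ∈ V.comap ι := by rw [← huz]; exact u.2
    exact (hdict hzK).mpr hzU
  · -- nontrivial over the node of `f₁`
    rw [hA₁, conjAct_smul_le_iff₃ U₀ hw₁, hlevel f₁]
    intro hle
    apply hnot
    intro z hz
    have hzK : z ∈ V.comap ι := by
      obtain ⟨x, hx, rfl⟩ := (Subgroup.mem_smul_pointwise_iff_exists _ _ _).mp hz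
      rw [ConjAct.smul_def, ConjAct.ofConjAct_toConjAct]
      exact hK' hx.2 f₁
    have h1 : ι z ∈ U₀.map V.subtype :=
      hle (Subgroup.le_topologicalClosure _ (Subgroup.mem_map_of_mem ι hz))
    exact (hdict hzK).mp h1

end SemiGraphOfAnabelioids.IsProSigmaCompletion

end Literature.AnabelianGeometry.SemiGraphs

end
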